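import Summits.NavierStokesRegularity.FluidComputer.PalasekTowerHostWave

/-!
# Host preparation, II: the cut-off Beltrami packet (identities)

Cell `ns-blowup`, seat `ns-blowup-ecbridge-3` (g0); GROUP C «BRIDGE SUPPORT» of the route
`PalasekTowerBreakdown` (crux `EpisodeBaseG`, item stmt-NavierStokesRegularity-19179, BC3 stub
`host_preparation` = the tree Prop `RungG 0`). LABEL: E–C typing (KERNEL construction). WHAT THIS
IS NOT: not Navier–Stokes evidence — elementary vector calculus of an explicit smooth field on `ℝ³`.

The CUT-OFF PACKET `packet λ χ := curl (χ • wave λ)` for a smooth scalar cut-off `χ` (companion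
`PalasekTowerHostWave.lean`: `wave λ = (sin λx₂, cos λx₂, 0)`, `curl wave = λ wave`): divergence free
as a curl (tree `divergence_curl_eq_zero_holds`); `packet = λχ • wave λ + packetCorr` with the
correction `packetCorr = ∇χ × wave λ` in the tree's basis-free form `curlCLM (Dχ ⊗ wave)` (Leibniz
rule `curl_smul`); its BELTRAMI DEFECT `packetDefect := curl packet − λ • packet = curl packetCorr`;
and the three identities the momentum equation of the host uses — `curl curl packet = λ² packet +
λ R + curl R`, `Δ packet = −(λ² packet + λ R + curl R)` (tree `laplacian_eq_neg_curl_curl`) and the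
Lamb form `(packet·∇)packet = R × packet + ∇(½|packet|²)` (tree
`convect_self_eq_cross_curl_add_gradient`, `(λ v) × v = 0`), `R = packetDefect`. Plateau lemmas
(`packet = λ • wave` and `D packet = λ • D wave` near points where `χ ≡ 1`) and support lemmas
(packet, correction, defect and its curl vanish off `tsupport χ`). Quantitative bounds in the
cut-off scale: `PalasekTowerHostCutoff.lean`.

References: A. J. Majda, A. L. Bertozzi, *Vorticity and Incompressible Flow* (CUP 2002), §2.3.2,
§2.1 eq. (2.5) [cite: MajdaBertozziCUP2002, §2.3.2]; S. Palasek, arXiv:2605.13827 §4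
[cite: Palasek2026ElementaryModel, §4].
-/

noncomputable section

namespace Summit.NavierStokesRegularity.FluidComputer.PalasekTowerClayBridge.Host

open Real Set Function Filter Topology InnerProductSpace
open scoped RealInnerProductSpace ContDiff Laplacian Topology
open Literature.Analysis.FluidPDE

/-- Local notation for physical space `ℝ³ = EuclideanSpace ℝ (Fin 3)`. -/
local notation "ℝ³" => EuclideanSpace ℝ (Fin 3)

/-! ## §2 The cut-off packet: identities -/

section Packet

variable (lam : ℝ) (χ : ℝ³ → ℝ)

/-- **The cut-off packet** `packet λ χ := curl (χ • wave λ)` — a compactly supported divergence-free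
field when `χ` is a compactly supported cut-off. [folklore] -/
def packet : ℝ³ → ℝ³ := curl fun y => χ y • wave lam y

/-- The rank-one field `y ↦ Dχ(y) ⊗ wave λ (y)`. [folklore] -/
def packetRank (y : ℝ³) : ℝ³ →L[ℝ] ℝ³ := (fderiv ℝ χ y).smulRight (wave lam y)

/-- **The cut-off correction** `packetCorr λ χ y = ∇χ(y) × wave λ (y)` (basis-free:
`curlCLM (Dχ(y) ⊗ wave λ (y))`). [folklore] -/
def packetCorr (y : ℝ³) : ℝ³ := curlCLM (packetRank lam χ y)

/-- **The Beltrami defect** of the packet: `R := curl packet − λ • packet`. [folklore] -/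
def packetDefect (y : ℝ³) : ℝ³ := curl (packet lam χ) y - lam • packet lam χ y

variable {lam χ}

/-- **The packet is `λχ • wave + ∇χ × wave`** (Leibniz rule for the curl, tree `curl_smul`, and
`curl wave = λ wave`). [folklore] -/
theorem packet_apply (hχ : Differentiable ℝ χ) (x : ℝ³) :
    packet lam χ x = (lam * χ x) • wave lam x + packetCorr lam χ x := by
  unfold packet packetCorr packetRank
  rw [curl_smul (hχ x) (differentiable_wave lam x), curl_wave, smul_smul, mul_comm]

/-- The packet as a function. [folklore] -/
theorem packet_eq (hχ : Differentiable ℝ χ) :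
    packet lam χ = fun x => (lam * χ x) • wave lam x + packetCorr lam χ x :=
  funext (packet_apply hχ)

/-- The potential `χ • wave λ` is smooth. [folklore] -/
theorem contDiff_potential (hχ : ContDiff ℝ ∞ χ) : ContDiff ℝ ∞ fun y => χ y • wave lam y :=
  hχ.smul (contDiff_wave lam)

/-- **The packet is smooth.** [folklore] -/
theorem contDiff_packet (hχ : ContDiff ℝ ∞ χ) : ContDiff ℝ ∞ (packet lam χ) :=
  contDiff_curl (n := ⊤) ((contDiff_potential hχ).of_le (by exact_mod_cast le_top))

/-- The packet is differentiable. [folklore] -/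
theorem differentiable_packet (hχ : ContDiff ℝ ∞ χ) : Differentiable ℝ (packet lam χ) :=
  (contDiff_packet hχ).differentiable (by simp)

/-- The rank-one field is smooth. [folklore] -/
theorem contDiff_packetRank (hχ : ContDiff ℝ ∞ χ) : ContDiff ℝ ∞ (packetRank lam χ) :=
  (hχ.fderiv_right (m := ∞) (by exact_mod_cast le_rfl)).smulRight (contDiff_wave lam)

/-- The correction is `curlCLM ∘ packetRank`. [folklore] -/
theorem packetCorr_eq_comp : packetCorr lam χ = curlCLM ∘ packetRank lam χ := rfl

/-- **The correction is smooth.** [folklore] -/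
theorem contDiff_packetCorr (hχ : ContDiff ℝ ∞ χ) : ContDiff ℝ ∞ (packetCorr lam χ) := by
  rw [packetCorr_eq_comp]
  exact curlCLM.contDiff.comp (contDiff_packetRank hχ)

/-- The defect is smooth. [folklore] -/
theorem contDiff_packetDefect (hχ : ContDiff ℝ ∞ χ) : ContDiff ℝ ∞ (packetDefect lam χ) :=
  (contDiff_curl (n := ⊤) ((contDiff_packet hχ).of_le (by exact_mod_cast le_top))).sub
    ((contDiff_packet hχ).const_smul lam)

/-- **The packet is divergence free** (`div curl = 0`, tree `divergence_curl_eq_zero_holds`).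
[folklore] -/
theorem isDivFree_packet (hχ : ContDiff ℝ ∞ χ) : VectorCalculus.IsDivFree (packet lam χ) := fun x =>
  divergence_curl_eq_zero_holds _ (contDiff_infty.1 (contDiff_potential (lam := lam) hχ) 2) x

/-- `(c • Dχ) ⊗ v = c • (Dχ ⊗ v)` under `curlCLM`. [folklore] -/
private theorem curlCLM_smulRight_smul (c : ℝ) (ℓ : ℝ³ →L[ℝ] ℝ) (v : ℝ³) :
    curlCLM ((c • ℓ).smulRight v) = c • curlCLM (ℓ.smulRight v) := by
  rw [← map_smul]
  congr 1
  ext h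
  simp [mul_smul]

/-- **The curl of the packet**: `curl packet = λ • packet + curl packetCorr` (so the Beltrami defect
is `curl packetCorr`). [folklore] -/
theorem curl_packet (hχ : ContDiff ℝ ∞ χ) (x : ℝ³) :
    curl (packet lam χ) x = lam • packet lam χ x + curl (packetCorr lam χ) x := by
  have hχd : Differentiable ℝ χ := hχ.differentiable (by simp)
  have h1 : DifferentiableAt ℝ (fun y => (lam * χ y) • wave lam y) x :=
    ((hχd x).const_mul lam).smul (differentiable_wave lam x)
  have h2 : DifferentiableAt ℝ (packetCorr lam χ) x :=
    ((contDiff_packetCorr hχ).differentiable (by simp)) x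
  rw [packet_eq hχd, curl_add h1 h2, curl_smul ((hχd x).const_mul lam) (differentiable_wave lam x),
    curl_wave, fderiv_const_mul (hχd x), curlCLM_smulRight_smul, smul_smul, smul_add, smul_smul,
    mul_comm (lam * χ x) lam]
  rfl

/-- **The Beltrami defect is the curl of the correction**: `packetDefect = curl packetCorr`.
[folklore] -/
theorem packetDefect_apply (hχ : ContDiff ℝ ∞ χ) (x : ℝ³) :
    packetDefect lam χ x = curl (packetCorr lam χ) x := by
  rw [packetDefect, curl_packet hχ, add_sub_cancel_left]

/-- `curl packet = λ • packet + R` as functions. [folklore] -/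
theorem curl_packet_eq (x : ℝ³) :
    curl (packet lam χ) x = lam • packet lam χ x + packetDefect lam χ x := by
  rw [packetDefect, add_sub_cancel]

/-- **`curl curl packet = λ² packet + λ R + curl R`**, `R` the Beltrami defect. [folklore] -/
theorem curl_curl_packet (hχ : ContDiff ℝ ∞ χ) (x : ℝ³) :
    curl (curl (packet lam χ)) x =
      lam ^ 2 • packet lam χ x + lam • packetDefect lam χ x + curl (packetDefect lam χ) x := by
  have e : curl (packet lam χ) = fun y => lam • packet lam χ y + packetDefect lam χ y :=
    funext curl_packet_eq
  have h1 : DifferentiableAt ℝ (fun y => lam • packet lam χ y) x :=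
    (differentiable_packet hχ x).const_smul lam
  have h2 : DifferentiableAt ℝ (packetDefect lam χ) x :=
    ((contDiff_packetDefect hχ).differentiable (by simp)) x
  rw [e, curl_add h1 h2, curl_const_smul (differentiable_packet hχ x), curl_packet_eq, smul_add,
    smul_smul, sq]

/-- **The Laplacian of the packet**: `Δ packet = −(λ² packet + λ R + curl R)` (`Δ = −curl curl` on
divergence-free fields, tree `laplacian_eq_neg_curl_curl`). [folklore] -/
theorem laplacian_packet (hχ : ContDiff ℝ ∞ χ) (x : ℝ³) :
    (Δ (packet lam χ)) x =
      -(lam ^ 2 • packet lam χ x + lam • packetDefect lam χ x + curl (packetDefect lam χ) x) := by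
  rw [laplacian_eq_neg_curl_curl (contDiff_infty.1 (contDiff_packet hχ) 2) (isDivFree_packet hχ) x,
    curl_curl_packet hχ]

/-- `(c • v) × v = 0`. [folklore] -/
theorem cross_smul_self (c : ℝ) (a : ℝ³) : cross (c • a) a = 0 := by
  ext i
  fin_cases i <;> simp [cross]

/-- **Lamb form of the packet's nonlinearity**: `(packet·∇)packet = R × packet + ∇(½|packet|²)`
(tree `convect_self_eq_cross_curl_add_gradient`, and `(λ packet) × packet = 0`). [folklore] -/
theorem convect_packet (hχ : ContDiff ℝ ∞ χ) (x : ℝ³) :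
    convect (packet lam χ) (packet lam χ) x =
      cross (packetDefect lam χ x) (packet lam χ x) +
        gradient (fun y => ‖packet lam χ y‖ ^ 2 / 2) x := by
  rw [convect_self_eq_cross_curl_add_gradient (differentiable_packet hχ x), curl_packet_eq,
    ← crossCLM_apply, map_add, add_apply, crossCLM_apply, crossCLM_apply, cross_smul_self, zero_add]

/-! ### Plateau and support -/

/-- **On a plateau of the cut-off the packet IS the wave**: if `χ ≡ 1` near `x` then
`packet = λ • wave` near `x`. [folklore] -/
theorem packet_eventuallyEq_of_plateau (hχ : Differentiable ℝ χ) {x : ℝ³}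
    (h : ∀ᶠ y in 𝓝 x, χ y = 1) : packet lam χ =ᶠ[𝓝 x] fun y => lam • wave lam y := by
  filter_upwards [h.eventually_nhds] with y hy
  have hD : fderiv ℝ χ y = 0 := by
    rw [Filter.EventuallyEq.fderiv_eq (hy.mono fun z hz => hz : χ =ᶠ[𝓝 y] fun _ => (1 : ℝ))]
    exact fderiv_const_apply _
  rw [packet_apply hχ, packetCorr, packetRank, hD, hy.self_of_nhds, mul_one]
  simp

/-- On a plateau, `packet x = λ • wave x`. [folklore] -/
theorem packet_apply_of_plateau (hχ : Differentiable ℝ χ) {x : ℝ³} (h : ∀ᶠ y in 𝓝 x, χ y = 1) :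
    packet lam χ x = lam • wave lam x :=
  (packet_eventuallyEq_of_plateau hχ h).self_of_nhds

/-- On a plateau, `D packet (x) = λ • D wave (x)`. [folklore] -/
theorem fderiv_packet_of_plateau (hχ : Differentiable ℝ χ) {x : ℝ³} (h : ∀ᶠ y in 𝓝 x, χ y = 1) :
    fderiv ℝ (packet lam χ) x = lam • fderiv ℝ (wave lam) x := by
  rw [(packet_eventuallyEq_of_plateau hχ h).fderiv_eq, fderiv_fun_const_smul (differentiable_wave lam x)]

/-- Off the support of the cut-off the correction vanishes. [folklore] -/
theorem packetCorr_eq_zero {x : ℝ³} (hx : x ∉ tsupport χ) : packetCorr lam χ x = 0 := by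
  rw [packetCorr, packetRank, fderiv_of_notMem_tsupport ℝ hx]
  simp

/-- Off the support of the cut-off the packet vanishes. [folklore] -/
theorem packet_eq_zero (hχ : Differentiable ℝ χ) {x : ℝ³} (hx : x ∉ tsupport χ) :
    packet lam χ x = 0 := by
  rw [packet_apply hχ, packetCorr_eq_zero hx, image_eq_zero_of_notMem_tsupport hx]
  simp

/-- A function vanishing off `tsupport g` has `tsupport ⊆ tsupport g`. [folklore] -/
theorem tsupport_subset_of_eq_zero {α : Type*} {f : ℝ³ → α} [Zero α] {g : ℝ³ → ℝ}
    (h : ∀ x, x ∉ tsupport g → f x = 0) : tsupport f ⊆ tsupport g := by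
  refine closure_minimal ?_ (isClosed_tsupport g)
  intro x hx
  by_contra hxg
  exact hx (h x hxg)

/-- The correction is supported in `tsupport χ`. [folklore] -/
theorem tsupport_packetCorr_subset : tsupport (packetCorr lam χ) ⊆ tsupport χ :=
  tsupport_subset_of_eq_zero fun _ hx => packetCorr_eq_zero hx

/-- The packet is supported in `tsupport χ`. [folklore] -/
theorem tsupport_packet_subset (hχ : Differentiable ℝ χ) : tsupport (packet lam χ) ⊆ tsupport χ :=
  tsupport_subset_of_eq_zero fun _ hx => packet_eq_zero hχ hx

/-- Off the support of the cut-off the defect vanishes. [folklore] -/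
theorem packetDefect_eq_zero (hχ : ContDiff ℝ ∞ χ) {x : ℝ³} (hx : x ∉ tsupport χ) :
    packetDefect lam χ x = 0 := by
  rw [packetDefect_apply hχ]
  exact curl_eq_zero_of_notMem_tsupport fun h => hx (tsupport_packetCorr_subset h)

/-- The defect is supported in `tsupport χ`. [folklore] -/
theorem tsupport_packetDefect_subset (hχ : ContDiff ℝ ∞ χ) :
    tsupport (packetDefect lam χ) ⊆ tsupport χ :=
  tsupport_subset_of_eq_zero fun _ hx => packetDefect_eq_zero hχ hx

/-- Off the support of the cut-off the curl of the defect vanishes. [folklore] -/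
theorem curl_packetDefect_eq_zero (hχ : ContDiff ℝ ∞ χ) {x : ℝ³} (hx : x ∉ tsupport χ) :
    curl (packetDefect lam χ) x = 0 :=
  curl_eq_zero_of_notMem_tsupport fun h => hx (tsupport_packetDefect_subset hχ h)

/-- The packet has compact support when the cut-off has. [folklore] -/
theorem hasCompactSupport_packet (hχ : Differentiable ℝ χ) (hc : HasCompactSupport χ) :
    HasCompactSupport (packet lam χ) :=
  IsCompact.of_isClosed_subset hc (isClosed_tsupport _) (tsupport_packet_subset hχ)

end Packet

end Summit.NavierStokesRegularity.FluidComputer.PalasekTowerClayBridge.Host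

end
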